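import Mathlib
import Summits.KontsevichZagierPeriods.Zeta5Search.Families.BasicGrowthSymmetryAPI
import Summits.KontsevichZagierPeriods.Zeta5Search.Families.RayGrowthSymmetry
import Summits.KontsevichZagierPeriods.Zeta5Search.Families.ConvergentSymmetries
import HarnessLib

/-!
# ζ(5) search — Families: the dihedral witnesses of `BasicGrowthSymmetryAPI` preserve Brown's convergence condition

HONEST FRAMING: systematic search; no irrationality claim unless certified.  STRUCTURAL (combinatorics of seatings);
nothing about the arithmetic of any zeta value.  Seat P2, Families layer.

Glue between `Families/BasicGrowthSymmetryAPI.lean` (the growth constant `M_σ` is constant on a dihedral class,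
`fSup_eq_of_dihedral`) and `Families/ConvergentSymmetries.lean` (Brown's condition `Convergent` is a class invariant):
the label reflection `reflIdx` of the symmetry files IS the place reflection `v ↦ c − v` with `c = ℓ + 1`
(`reflIdx_eq_sub`), hence `convergent_reflIdx_iff`, and every relabelled seating `dihedralImage σ c k rev refl` is
convergent iff `σ` is (`convergent_dihedralImage_iff`).  So a census class carries ONE growth constant and ONE
convergence bit.  Standard axioms only.
-/

namespace Summit.KontsevichZagierPeriods.Zeta5Search.Families.Cellular

variable {ℓ : ℕ} (σ : Fin (ℓ + 3) → Fin (ℓ + 3))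

/-- The label reflection is the affine map `u ↦ (ℓ + 1) − u` of `ℤ/(ℓ+3)` (it fixes `∞ = ℓ + 2 ≡ −1`). -/
theorem reflIdx_eq_sub (u : Fin (ℓ + 3)) : reflIdx u = (Fin.last (ℓ + 2) - 1) - u := by
  apply Fin.ext
  have hu := u.isLt
  have h1 : ((Fin.last (ℓ + 2) - 1 : Fin (ℓ + 3)) : ℕ) = ℓ + 1 := by
    rw [Fin.coe_sub_one, if_neg (Fin.last_pos').ne', Fin.val_last]
    rfl
  rw [reflIdx_val]
  split_ifs with h
  · -- `u = ∞`: `(ℓ+1) − (ℓ+2) ≡ ℓ + 2`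
    have hlt : (Fin.last (ℓ + 2) - 1 : Fin (ℓ + 3)) < u := by
      rw [Fin.lt_def, h1]; omega
    rw [(Fin.coe_sub_iff_lt).2 hlt, h1]
    omega
  · have hle : u ≤ (Fin.last (ℓ + 2) - 1 : Fin (ℓ + 3)) := by
      rw [Fin.le_def, h1]; omega
    rw [(Fin.coe_sub_iff_le).2 hle, h1]

/-- **`Convergent (reflIdx ∘ σ) ↔ Convergent σ`.** -/
theorem convergent_reflIdx_iff : Convergent (fun i => reflIdx (σ i)) ↔ Convergent σ := by
  simp only [reflIdx_eq_sub]
  exact convergent_sub_iff σ _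

/-- **Every dihedral witness preserves convergence**: `Convergent (dihedralImage σ c k rev refl) ↔ Convergent σ`. -/
theorem convergent_dihedralImage_iff (c : Fin (ℓ + 3)) (k : ℕ) (rev refl : Bool) :
    Convergent (dihedralImage σ c k rev refl) ↔ Convergent σ := by
  unfold dihedralImage
  cases rev <;> cases refl <;> simp only [Bool.false_eq_true, ↓reduceIte]
  · rw [convergent_add_iff (fun i => σ (c + i))]
    simpa only [add_comm] using convergent_comp_add_iff σ c
  · rw [convergent_add_iff (fun i => reflIdx (σ (c + i))), convergent_reflIdx_iff (fun i => σ (c + i))]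
    simpa only [add_comm] using convergent_comp_add_iff σ c
  · rw [convergent_add_iff (fun i => σ (c - i))]
    exact convergent_comp_sub_iff σ c
  · rw [convergent_add_iff (fun i => reflIdx (σ (c - i))), convergent_reflIdx_iff (fun i => σ (c - i))]
    exact convergent_comp_sub_iff σ c

/-! ## Appended (P2 g4): the induced map on edge positions is affine too -/

/-- The reflection of the `δ⁰`-edge positions is the affine map `i ↦ ℓ − i` of `ℤ/(ℓ+3)`
(`ℓ + 1 ↦ −1 = ∞`-edge, `ℓ + 2 ↦ −2`). -/
theorem reflPos_eq_sub (i : Fin (ℓ + 3)) : reflPos i = (Fin.last (ℓ + 2) - 1 - 1) - i := by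
  apply Fin.ext
  have hi := i.isLt
  have h1 : ((Fin.last (ℓ + 2) - 1 : Fin (ℓ + 3)) : ℕ) = ℓ + 1 := by
    rw [Fin.coe_sub_one, if_neg (Fin.last_pos').ne', Fin.val_last]
    rfl
  have hne : (Fin.last (ℓ + 2) - 1 : Fin (ℓ + 3)) ≠ 0 := by
    intro h; have := congrArg Fin.val h; rw [h1] at this; simp at this
  have h2 : ((Fin.last (ℓ + 2) - 1 - 1 : Fin (ℓ + 3)) : ℕ) = ℓ := by
    rw [Fin.coe_sub_one, if_neg hne, h1]
    rfl
  rw [reflPos_val]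
  split_ifs with ha hb
  · have hle : i ≤ (Fin.last (ℓ + 2) - 1 - 1 : Fin (ℓ + 3)) := by rw [Fin.le_def, h2]; exact ha
    rw [(Fin.coe_sub_iff_le).2 hle, h2]
  · have hlt : (Fin.last (ℓ + 2) - 1 - 1 : Fin (ℓ + 3)) < i := by rw [Fin.lt_def, h2]; omega
    rw [(Fin.coe_sub_iff_lt).2 hlt, h2]
    omega
  · have hlt : (Fin.last (ℓ + 2) - 1 - 1 : Fin (ℓ + 3)) < i := by rw [Fin.lt_def, h2]; omega
    rw [(Fin.coe_sub_iff_lt).2 hlt, h2]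
    omega

end Summit.KontsevichZagierPeriods.Zeta5Search.Families.Cellular
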